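import Summits.BirchSwinnertonDyer.BirchSwinnertonDyer.Theses.GenusKolyvaginAtTwo

/-!
# Route `GenusKolyvaginAtTwo`, LINE 13_T (REPAIR-3 «OddTam»): the glue of the Q3R_T split holds (by name)

Item `EquivariantKolyvaginExactAtTwoRTOfHalves` (support/glue of the split of crux
`EquivariantKolyvaginExactAtTwoRT` = Q3R_T — the odd-Tamagawa re-typing of Q3R 27720 — into its two
divisibility halves U_T `ShaCardDvdPowAtTwoRT` (`#Ш(E/K)[2^∞] ∣ 2^(2M₀)`, annihilation) and
L_T `PowDvdShaCardAtTwoRT` (`2^(2M₀) ∣ #Ш(E/K)[2^∞]`, structure ladder)). Pen seat `bsd-idea-1` g10.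
THEOREM-ONLY file (no definition, no named fact, no `sorry`): pure logic — introduce the common frame
(one binder more than LINE 13: `hT : Odd W.tamagawaProduct`) and apply `Nat.dvd_antisymm`.
BSD is not proved by this; Q3R_T is not proved by this (children ⟹ parent only); U_T and L_T stay open.

Rev 2 (pen `bsd-idea-1` g16, ahead of route rev 31 = the (D-NPh) scope restriction «W has an odd prime of
multiplicative reduction», director-bsd g18 (382)(4)(i), LEAD gk2-p1 kit `Cruxes/PowDvdShaCardAtTwoRT/Lines/
plus-descent-restate31-kit.md`): the proof is made SHAPE-AGNOSTIC — it introduces the parent's frame with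
`repeat (intro _)` and discharges each child's hypotheses by `assumption` — so that this module keeps compiling
in every state of the restate sequence Q3R_T → U_T → L_T (texts (30,30,30), (30,30,31), (31,30,31),
(31,31,31); all four checked in the pen's scratch `rev31/glue_robust_check.lean`, farm rc 0). Same theorem
name and type; nothing new is claimed.
-/

set_option autoImplicit false
set_option linter.dupNamespace false

namespace Summit.BirchSwinnertonDyer.BirchSwinnertonDyer.Theorems.GenusExact

open Summit.BirchSwinnertonDyer.BirchSwinnertonDyer.Theses.GenusKolyvaginAtTwo

/-- **Glue of LINE 13_T** (by name): `ShaCardDvdPowAtTwoRT → PowDvdShaCardAtTwoRT → EquivariantKolyvaginExactAtTwoRT`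
— antisymmetry of `∣` on `ℕ` after introducing the common frame (rev 39 / R7-d cut, LEAD gk2-p1 g19 text: explicit binders). [folklore] -/
theorem equivariantKolyvaginExactAtTwoRTOfHalves_proof : EquivariantKolyvaginExactAtTwoRTOfHalves := by
  intro h₁ h₂ hQ2 hQ5R hQ1 W _ _ _ hcm hT v h2v hNv hmult hneg K _ _ hIQ hodd h3 hHe hsq1 hsq2 hρ Dt β ι d₁ hy M₀ hdiv hndiv
    hw Wd _ _ hWd hSel hDEF n d hn hKoly hPn
  -- rev 39 (R7-d, LEAD gk2-p1 g19 text): the parent's frame carries the live-configuration cut `hw Wd _ _ hWd hSel hDEF` right after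
  -- `hndiv`; U_T (restated, Kolyvagin-prime binders dropped) consumes the cut and not `n d`, L_T consumes `n d` and not the cut.
  exact Nat.dvd_antisymm
    (h₁ hQ2 hQ5R hQ1 W hcm hT v h2v hNv hmult hneg K hIQ hodd h3 hHe hsq1 hsq2 hρ Dt β ι d₁ hy M₀ hdiv hndiv hw Wd hWd hSel hDEF)
    (h₂ hQ2 hQ5R hQ1 W hcm hT v h2v hNv hmult hneg K hIQ hodd h3 hHe hsq1 hsq2 hρ Dt β ι d₁ hy M₀ hdiv hndiv n d hn hKoly hPn)

end Summit.BirchSwinnertonDyer.BirchSwinnertonDyer.Theorems.GenusExact
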